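import Literature.MathematicalPhysics.QuantumFieldTheory.Balaban1983to89.B9Thm37GlueLevelSumOsc
import Literature.MathematicalPhysics.QuantumFieldTheory.Balaban1983to89.B9Thm37GluePU

/-!
# `Balaban1983to89.B9Thm37GlueTowerEntry4` — entry 4 of (3.42) for G′ IN THE TORUS MODEL with the AVERAGING PART OF Δ′_a THE
# TOWER'S MULTI-LEVEL Q′\*aQ′ = Σ_{l≤k} a_lG_lᵀG_l and its five Q-binders DISCHARGED (`B9Thm37GluePU.thm37_entry4_torus` ∘
# `B9Thm37GlueLevelSumOsc.commData_towerLevelSum_of_bondBound`; cell `pub-ymgap`, Track A node N06 [B9] second -b seat dag-n19-b;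
# count-neutral MODEL bookkeeping)

References (bib keys): [B9] = `Balaban1985BackgroundPropagators`; [4] = `Balaban1984PropagatorsII`; [3] = `Balaban1984PropagatorsI` —
only NAMED, loci certified in the headers of `B9Thm37GluePU` ∕ `B9Thm37GlueSz` ∕ `B9Thm37GlueLevelSumComm`.

THE POINT.  `B9Thm37GluePU.thm37_entry4_torus` (Theorem 3.7 ⇒ entry 4 of (3.42) for G′ in the torus model of the partition of
unity of [3] (1.118)) carries the averaging part `Qf` of Δ′_a ABSTRACTLY with five binders `hQ hKQ hlocQ hrowQ` (+ κ_Q): the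
commutator [M_{h_□}, Q′\*aQ′] majorised by a located kernel with row sums κ_Q·1_{S′_□}.  HERE `Qf` IS the tower's level sum
`Σ_{l≤k} a_lG_lᵀG_l` (`B9Thm37GlueTorusCovLevels.levelSum` over `towerBlk`∕`towerTr` of the torus cube-comb tower
`B9Thm37GlueTorusCovTower.torusTower`, sides `M_j`) and those binders are THEOREMS (`commData_towerLevelSum_of_bondBound` with the
per-bond bound 4d∕M₀ of `hθ_torus`, comb depths d(M_j − 1), block counts M_j^d): what stays displayed is the block-weight bound
`|W_l| ≤ wb_l`, the size letters `k_l ≥ |a_l|wb_l²(#Cp)²(Π_{j<l}M_j^d)(L^{j_b}η)²`, the nesting of the geometry blocking over the top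
tower level, and the located support of h_z (`hS′`).  κ_Q = Σ_{l≤k} (2(Σ_{j<l} d(M_j − 1))·4d∕M₀)·k_l — print's «O(M⁻¹)».  Every
OTHER hypothesis of the lineage's theorem is carried verbatim (Cor. 3.6 for the G′_□, the block maps and their geometry, the
volume products, `hloc`, `hinv`, Lemma 2.1 of [4], located smallness) — NOT asserted.

HONEST SCOPE.  As `B9Thm37GluePU` + `B9Thm37GlueLevelSumComm`: component MODEL; nothing of print asserted; NOT a node discharge;
NOT continuum, NOT Clay.
-/

namespace Literature.MathematicalPhysics.QuantumFieldTheory.Balaban1983to89.B9Thm37GlueTowerEntry4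

open Literature.MathematicalPhysics.QuantumFieldTheory.Balaban1983to89
open Finset B6RandomWalk B6RandomWalkHom B9Thm37Sum B9Thm34Ext B9Thm37Glue B9Thm37GlueTorusCov B9Thm37GlueTorusCovComp
  B9Thm37GlueTorusCovLevels B9Thm37GlueTorusCovTower B9Thm37GluePU B9Thm37GlueLevelSumComm B9Thm37GlueLevelSumOsc

noncomputable section

variable {d : ℕ} {N : Fin d → ℕ} [∀ i, NeZero (N i)] [NeZero d] {g : B9.Geometry} [Fintype g.Site] [DecidableEq g.Site]
  {R : ℝ} {H : Prop} {Cp : Type}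

/-- **THEOREM 3.7 ⇒ ENTRY 4 OF (3.42) FOR G′, TORUS MODEL, WITH THE MULTI-LEVEL AVERAGING PART AND ITS Q-BINDERS DISCHARGED**
= `B9Thm37GluePU.thm37_entry4_torus` at `Qf := Σ_{l≤k} a_lG_lᵀG_l` (the torus cube-comb tower of sides `M_j`, block weights
`W_l`, coefficients `a_l`), its `hQ hKQ hlocQ hrowQ` supplied by `B9Thm37GlueLevelSumOsc.commData_towerLevelSum_of_bondBound`
with θ = 4d∕M₀ (`hθ_torus`), D_j = d(M_j − 1) (`tdepth_le`), n_j = M_j^d (`card_block_le`), and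
κ_Q := Σ_l (2(Σ_{j<l} d(M_j − 1))·(4d∕M₀))·k_l.  New displayed binders: `hW` (|W_l| ≤ wb_l), `hkk`∕`hk` (size letters),
`hnestTop` (the geometry blocking factors through the top tower level), `hS'` (h_z ≠ 0 only on blocks of S′_z); all others verbatim
from the lineage (NOT asserted). [cite: Balaban1985BackgroundPropagators, Thm 3.7 (3.87)–(3.90) pp.408–410 + (3.42) p.397 + (3.16) p.393; Balaban1984PropagatorsII, (2.36) p.229 + (2.40)–(2.44) p.230; Balaban1984PropagatorsI, (1.118) p.36] -/
theorem thm37_entry4_torusTower [Fintype Cp] [DecidableEq Cp] {M₀ : ℕ} (hM : 1 ≤ M₀) (hdiv : ∀ i, M₀ ∣ N i)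
    (h2N : ∀ i, 2 * M₀ ≤ N i) (c₀ : ℝ)
    {M : ℕ → ℕ} (hMj : ∀ j, 1 ≤ M j) (hdivj : ∀ j i, M j ∣ N i) (k : ℕ) (W : Fin (k + 1) → B5TorusCover.UT N → ℝ)
    (a : Fin (k + 1) → ℝ) (wb kk : Fin (k + 1) → ℝ)
    (blk : B5TorusCover.UT N × Cp → g.Site) (blkY : (B5TorusCover.UT N × Fin d) × Cp → g.Site)
    (Rm : B5TorusCover.UT N × Fin d → Cp → Cp → ℝ) (dd : ℕ) (δ₀ α ρ B₀ v₁ v₂ Nn N' : ℝ)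
    (S S' : B5TorusCover.Ctr N M₀ → Finset g.Site) {G' : Module.End ℝ (B5TorusCover.UT N × Cp → ℝ)}
    (hRm : ∀ b i j, ∑ k, Rm b k i * Rm b k j = if i = j then 1 else 0)
    (hB₀ : 0 ≤ B₀) (hδ₀ : 0 ≤ δ₀) (hρ : 0 ≤ ρ) (hv₁ : 0 ≤ v₁) (hv₂ : 0 ≤ v₂) (hkk : ∀ l, 0 ≤ kk l) (hN : 0 ≤ Nn)
    (hN' : 0 ≤ N') (hαδ : 0 ≤ (1 - α) * δ₀)
    (htri : Triangle254 (toB6 g R H)) (hrefl : ∀ y : g.Site, g.dist y y = 0)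
    (hdnn : ∀ y y' : g.Site, 0 ≤ g.dist y y') (hlen : ∀ y : g.Site, 0 ≤ g.len y)
    (h261 : Ineq261 dd (toB6 g R H) δ₀ α) (h263 : Ineq263 dd (toB6 g R H) δ₀ α)
    (hsmall : N' * (B₀ * Real.exp (δ₀ * ρ) * ((d + d * Fintype.card Cp : ℝ) * v₁ + (v₂ +
      ∑ l : Fin (k + 1), (2 * (∑ j ∈ Finset.range l, d * (M j - 1) : ℕ) * (4 * d / (M₀ : ℝ))) * kk l))) *
      B6.c1 dd δ₀ α < 1)
    (hS : ∀ i (p : B5TorusCover.UT N × Cp), B5SmoothPartition.hSU N M₀ i p.1 ≠ 0 → blk p ∈ S i)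
    (hS' : ∀ i (p : B5TorusCover.UT N × Cp), B5SmoothPartition.hSU N M₀ i p.1 ≠ 0 → blk p ∈ S' i)
    (hcnt : ∀ a : g.Site, (∑ i, if a ∈ S i then (1 : ℝ) else 0) ≤ Nn)
    (hcnt' : ∀ a : g.Site, (∑ i, if a ∈ S' i then (1 : ℝ) else 0) ≤ N')
    (hsupp : ∀ i b, B5SmoothPartition.hSU N M₀ i (btgt b) ≠ B5SmoothPartition.hSU N M₀ i (bsrc b) →
      (∀ j, blk (bsrc b, j) ∈ S' i ∧ blk (btgt b, j) ∈ S' i) ∧ ∀ k, blkY (b, k) ∈ S' i)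
    (hadj : ∀ b i k, g.dist (blk (bsrc b, i)) (blkY (b, k)) ≤ ρ ∧ g.dist (blk (btgt b, i)) (blkY (b, k)) ≤ ρ ∧
      g.dist (blkY (b, k)) (blk (bsrc b, i)) ≤ ρ ∧ g.dist (blkY (b, k)) (blk (btgt b, i)) ≤ ρ)
    (hV₁ : ∀ i (a : g.Site), a ∈ S' i →
      |c₀| * (4 * d / (M₀ : ℝ)) * ∑ y ∈ (S' i).filter (fun y => g.dist a y ≤ ρ), g.len y ≤ v₁)
    (hV₂ : ∀ i (a : g.Site), a ∈ S' i → c₀ ^ 2 * (52 * d / (M₀ : ℝ) ^ 2) * g.len a ^ 2 ≤ v₂)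
    (hnestTop : ∀ p q : B5TorusCover.UT N × Cp,
      towerBlk (torusTower hMj hdivj) k q.1 = towerBlk (torusTower hMj hdivj) k p.1 → blk q = blk p)
    (hW : ∀ l x, |W l x| ≤ wb l)
    (hk : ∀ l (b : g.Site),
      |a l| * (wb l ^ 2 * (Fintype.card Cp : ℝ) ^ 2 * towerN (fun j => M j ^ d) l) * g.len b ^ 2 ≤ kk l)
    {Gsq : B5TorusCover.Ctr N M₀ → Module.End ℝ (B5TorusCover.UT N × Cp → ℝ)}
    (h342_1 : ∀ i, HasMajorant (g := toB6 g R H) blk (Gsq i)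
      (fun a b => B₀ * g.len a ^ 2 * Real.exp (-(δ₀ * g.dist a b))))
    (h342_2 : ∀ i, HasMajorantHom (g := toB6 g R H) blk blkY
      (covD bsrc btgt (fun _ : B5TorusCover.UT N × Fin d => c₀) Rm ∘ₗ Gsq i)
      (fun a b => B₀ * g.len a * Real.exp (-(δ₀ * g.dist a b))))
    (h342_4 : ∀ i, HasMajorantHom (g := toB6 g R H) blk blk
      ((covDT bsrc btgt (fun _ : B5TorusCover.UT N × Fin d => c₀) Rm ∘ₗ covD bsrc btgt (fun _ : B5TorusCover.UT N × Fin d => c₀) Rm) ∘ₗ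
        Gsq i)
      (fun a b => B₀ * Real.exp (-(δ₀ * g.dist a b))))
    (hloc : ∀ i, mulOp (B5SmoothPartition.hSU N M₀ i ∘ Prod.fst) *
      (covDT bsrc btgt (fun _ : B5TorusCover.UT N × Fin d => c₀) Rm ∘ₗ covD bsrc btgt (fun _ : B5TorusCover.UT N × Fin d => c₀) Rm +
        levelSum (fun l : Fin (k + 1) => towerBlk (torusTower hMj hdivj) (l : ℕ)) W
          (fun l => towerTr (torusTower hMj hdivj) Rm (l : ℕ)) a) *
      Gsq i * mulOp (B5SmoothPartition.hSU N M₀ i ∘ Prod.fst) = mulOp (B5SmoothPartition.hSU N M₀ i ∘ Prod.fst) * mulOp (B5SmoothPartition.hSU N M₀ i ∘ Prod.fst))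
    (hinv : G' * (covDT bsrc btgt (fun _ : B5TorusCover.UT N × Fin d => c₀) Rm ∘ₗ
      covD bsrc btgt (fun _ : B5TorusCover.UT N × Fin d => c₀) Rm +
        levelSum (fun l : Fin (k + 1) => towerBlk (torusTower hMj hdivj) (l : ℕ)) W
          (fun l => towerTr (torusTower hMj hdivj) Rm (l : ℕ)) a) = 1) :
    HasMajorantHom (g := toB6 g R H) blk blk
      ((covDT bsrc btgt (fun _ : B5TorusCover.UT N × Fin d => c₀) Rm ∘ₗ covD bsrc btgt (fun _ : B5TorusCover.UT N × Fin d => c₀) Rm) ∘ₗ G')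
      (fun (a b : g.Site) => B₀ * (Nn + N' * Real.exp (δ₀ * ρ) * ((d + d * Fintype.card Cp : ℝ) * v₁ + v₂)) *
        B6.c1 dd δ₀ α *
        (1 - N' * (B₀ * Real.exp (δ₀ * ρ) * ((d + d * Fintype.card Cp : ℝ) * v₁ + (v₂ +
          ∑ l : Fin (k + 1), (2 * (∑ j ∈ Finset.range l, d * (M j - 1) : ℕ) * (4 * d / (M₀ : ℝ))) * kk l))) *
          B6.c1 dd δ₀ α)⁻¹ *
        Real.exp (-((1 - α) * δ₀ * g.dist a b))) := by
  -- the five Q-binders of the tower's averaging part, from the per-bond bound of hSU and the comb paths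
  have hθ0 : (0 : ℝ) ≤ 4 * d / (M₀ : ℝ) := by positivity
  have hθ : ∀ (z : B5TorusCover.Ctr N M₀) (b : B5TorusCover.UT N × Fin d), |B5SmoothPartition.hSU N M₀ z (btgt b) - B5SmoothPartition.hSU N M₀ z (bsrc b)| ≤ 4 * d / (M₀ : ℝ) :=
    fun z b => by simpa only [one_mul, abs_one] using hθ_torus (N := N) hM (1 : ℝ) z b
  have hzero : ∀ (z : B5TorusCover.Ctr N M₀) (p : B5TorusCover.UT N × Cp), blk p ∉ S' z → B5SmoothPartition.hSU N M₀ z p.1 = 0 := fun z p hp => by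
    by_contra hne
    exact hp (hS' z p hne)
  obtain ⟨hQ, hKQ, hlocQ, hrowQ, -⟩ := commData_towerLevelSum_of_bondBound (g := g) (R := R) (H := H)
    (torusTower hMj hdivj) Rm hRm k W a wb (fun j => M j ^ d) (fun j => d * (M j - 1)) blk hnestTop hW
    (fun j z => B9Thm37GlueTorusCovPoinc.card_block_le (hMj j) (hdivj j) z)
    (fun j y => B9Thm37GlueTorusCovPoinc.tdepth_le (hMj j) y) ρ (fun b => by rw [hrefl b]; exact hρ) kk hk
    (B5SmoothPartition.hSU N M₀) S' hθ0 hθ hzero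
  have hκQ : 0 ≤ ∑ l : Fin (k + 1), (2 * (∑ j ∈ Finset.range l, d * (M j - 1) : ℕ) * (4 * d / (M₀ : ℝ))) * kk l :=
    Finset.sum_nonneg fun l _ => mul_nonneg (by positivity) (hkk l)
  exact thm37_entry4_torus hM hdiv h2N c₀ blk blkY Rm _ dd δ₀ α ρ B₀ v₁ v₂ _ Nn N' S S' _ hRm hB₀ hδ₀ hρ hv₁ hv₂
    hκQ hN hN' hαδ htri hrefl hdnn hlen h261 h263 hsmall hS hcnt hcnt' hsupp hadj hV₁ hV₂ hKQ hlocQ hrowQ h342_1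
    h342_2 h342_4 hQ hloc hinv

end

end Literature.MathematicalPhysics.QuantumFieldTheory.Balaban1983to89.B9Thm37GlueTowerEntry4
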